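import Mathlib
import HarnessLib
import Literature.Analysis.FluidPDE.Tao2016AveragedNS.TaylorChainCertificate
import Summits.NavierStokesRegularity.NavierStokesRegularity.Theorems.TaylorModelRungThreeReadoutPackage

/-!
# Line `taylor-model` on crux K1b-DR (stmt-NavierStokesRegularity-23954) — stub G3 (`stub_tube : TubeLip`),
# helper file 1: certificate toolkit (window balls, scaling, node times)

Helper lemmas (namespace `…Theorems.TaylorModelReadout.G3`) used by the proof of the registered stub
`stub_tube : TubeLip` of skeleton v4 (line owner ns-idea-2 g3; statement `…ReadoutStubDefs.TubeLip`,
over the landed vocabulary `IsFlowPackage` / `ChainEnclosure` / `Crossing` / `KBlockTube` / `KBlockLip` of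
`…TaylorModelRungThreeReadoutPackage` and the certificate record `TaylorChain.CertData`):

* projections of `CertData.Valid` used repeatedly (positivity of `ω`, `κ`, the sub-step clauses of `Chain`);
* the algebra of the window balls `cd.InBall j` (monotonicity, sums, scalars, convexity of the κ-box) and the
  SCALING lemma for window-profile bounds of `ℝ`-linear maps (`linear_scale`);
* the node times `Tn`: monotonicity and location of a time in a sub-step (`exists_substep`);

(The flow property, the linearity of `Vap` and the (F4) Lipschitz estimate are in the sibling helper
`…ReadoutG3Flow`.)

MODEL-lattice bookkeeping only (rung TL-M3 of the NS ladder); nothing here is a statement about the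
Navier–Stokes equations.
-/

noncomputable section

-- the sub-problem namespace repeats the summit name by design (D-0017)
set_option linter.dupNamespace false

namespace Summit.NavierStokesRegularity.NavierStokesRegularity.Theorems.TaylorModelReadout.G3

open Set Filter
open Literature.Analysis.FluidPDE.TaoCascade Literature.Analysis.FluidPDE.TaoCascade.TaylorChain
open Summit.NavierStokesRegularity.NavierStokesRegularity.Theorems.TaylorModelReadout

variable {cd : CertData} {j : ℕ}

/-! ### Projections of `Valid` -/

/-- Stage weights are positive. [folklore] -/
theorem omega_pos (hV : cd.Valid) (hj : j ≤ cd.N₀) : ∀ k, 0 < cd.ω j k := (hV.2.1.1 j hj).2.2.2.2.2.2.1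

/-- The tube radius `κ j` is positive. [folklore] -/
theorem kappa_pos (hV : cd.Valid) (hj : j ≤ cd.N₀) : 0 < cd.κ j := (hV.2.1.1 j hj).2.2.2.1

/-- `0 ≤ Λ j`. [folklore] -/
theorem Lambda_nonneg (hV : cd.Valid) (hj : j ≤ cd.N₀) : 0 ≤ cd.Λ j := (hV.2.1.1 j hj).2.2.2.2.1

/-- `0 ≤ δ j`. [folklore] -/
theorem delta_nonneg (hV : cd.Valid) (hj : j ≤ cd.N₀) : 0 ≤ cd.δ j := (hV.2.1.1 j hj).2.2.2.2.2.1

/-- `0 ≤ bb j`. [folklore] -/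
theorem bb_nonneg (hV : cd.Valid) (hj : j ≤ cd.N₀) : 0 ≤ cd.bb j := (hV.2.1.2 j hj).1

/-- `0 < τs`. [folklore] -/
theorem taus_pos (hV : cd.Valid) : 0 < cd.τs := hV.1.2.2.2.2.2.2.2.2.2.2.2.2.1

/-- `0 < mm`. [folklore] -/
theorem mm_pos (hV : cd.Valid) : 0 < cd.mm := hV.1.2.2.2.2.2.2.2.2.2.2.2.2.2.2.1

/-- `0 ≤ Kb`. [folklore] -/
theorem Kb_nonneg (hV : cd.Valid) : 0 ≤ cd.Kb := hV.1.2.2.2.2.2.2.2.2.2.2.1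

/-- `1 ≤ Ka`. [folklore] -/
theorem one_le_Ka (hV : cd.Valid) : 1 ≤ cd.Ka := hV.1.2.2.2.2.2.2.2.2.2.2.2.1

/-- `1 ≤ S j`. [folklore] -/
theorem one_le_S (hV : cd.Valid) (hj : j ≤ cd.N₀) : 1 ≤ cd.S j := (hV.2.2.1 j hj).1

/-- `Tn j 0 = 0`. [folklore] -/
theorem Tn_zero (hV : cd.Valid) (hj : j ≤ cd.N₀) : cd.Tn j 0 = 0 := (hV.2.2.1 j hj).2.1

/-- `0 < h j s`. [folklore] -/
theorem h_pos (hV : cd.Valid) (hj : j ≤ cd.N₀) {s : ℕ} (hs : s < cd.S j) : 0 < cd.h j s := ((hV.2.2.1 j hj).2.2.2.2.2.2.2 s hs).1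

/-- `Tn j (s+1) = Tn j s + h j s`. [folklore] -/
theorem Tn_succ (hV : cd.Valid) (hj : j ≤ cd.N₀) {s : ℕ} (hs : s < cd.S j) :
    cd.Tn j (s + 1) = cd.Tn j s + cd.h j s := ((hV.2.2.1 j hj).2.2.2.2.2.2.2 s hs).2.2.2.1

/-- `rP ≥ 0`. [folklore] -/
theorem rP_nonneg (hV : cd.Valid) (hj : j ≤ cd.N₀) {s : ℕ} (hs : s ≤ cd.S j) :
    ∀ i k, 0 ≤ cd.rP j s i k := ((hV.2.2.1 j hj).2.2.2.2.2.2.1 s hs).2.2.2.2.1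

/-- `Cm j s` is linear. [folklore] -/
theorem isLinearMap_Cm (hV : cd.Valid) (hj : j ≤ cd.N₀) {s : ℕ} (hs : s ≤ cd.S j) :
    IsLinearMap ℝ (cd.Cm j s) := ((hV.2.2.1 j hj).2.2.2.2.2.2.1 s hs).2.2.2.2.2.2.2.2.2.2.2.1

/-- `Ci j s` is linear. [folklore] -/
theorem isLinearMap_Ci (hV : cd.Valid) (hj : j ≤ cd.N₀) {s : ℕ} (hs : s ≤ cd.S j) :
    IsLinearMap ℝ (cd.Ci j s) := ((hV.2.2.1 j hj).2.2.2.2.2.2.1 s hs).2.2.2.2.2.2.2.2.2.2.2.2.1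

/-- Window support of the frame maps and the exact-inverse identities. [folklore] -/
theorem frame_wsupp (hV : cd.Valid) (hj : j ≤ cd.N₀) {s : ℕ} (hs : s ≤ cd.S j) :
    ∀ v, cd.Wsupp (cd.Cm j s v) ∧ cd.Wsupp (cd.Ci j s v) ∧
      (cd.Wsupp v → cd.Ci j s (cd.Cm j s v) = v ∧ cd.Cm j s (cd.Ci j s v) = v) :=
  ((hV.2.2.1 j hj).2.2.2.2.2.2.1 s hs).2.2.2.2.2.2.2.2.2.2.2.2.2.1

/-- The parallelepiped of sub-step `s` sits in the balls `Ball(ρ − E)` and `Ball(ρO − EO)`. [folklore] -/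
theorem para_inBall (hV : cd.Valid) (hj : j ≤ cd.N₀) {s : ℕ} (hs : s ≤ cd.S j) :
    ∀ ξ : (Fin 4 → ℤ → ℝ), (∀ i k, -cd.Kb ≤ k → k ≤ cd.Ka → |ξ i k| ≤ cd.rP j s i k) →
      cd.InBall j (cd.Cm j s ξ) (cd.ρ j s - cd.E j s) ∧ cd.InBall j (cd.Cm j s ξ) (cd.ρO j s - cd.EO j s) :=
  ((hV.2.2.1 j hj).2.2.2.2.2.2.1 s hs).2.2.2.2.2.2.2.2.2.2.2.2.2.2.1

/-- The `NCi` clause: `Ci` maps the unit window ball into `NCi · rP` units. [folklore] -/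
theorem NCi_clause (hV : cd.Valid) (hj : j ≤ cd.N₀) {s : ℕ} (hs : s ≤ cd.S j) :
    0 ≤ cd.NCi j s ∧ ∀ v : (Fin 4 → ℤ → ℝ), cd.InBall j v 1 →
      ∀ i k, -cd.Kb ≤ k → k ≤ cd.Ka → |cd.Ci j s v i k| ≤ cd.NCi j s * cd.rP j s i k :=
  ((hV.2.2.1 j hj).2.2.2.2.2.2.1 s hs).2.2.2.2.2.2.2.2.2.2.2.2.2.2.2.1

/-! ### Window balls -/

/-- Monotonicity of window balls in the radius. [folklore] -/
theorem inBall_mono (hω : ∀ k, 0 < cd.ω j k) {y : Fin 4 → ℤ → ℝ} {N N' : ℝ} (h : cd.InBall j y N)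
    (hle : N ≤ N') : cd.InBall j y N' :=
  fun i k hk1 hk2 => (h i k hk1 hk2).trans (mul_le_mul_of_nonneg_right hle (hω k).le)

/-- Sums of window balls. [folklore] -/
theorem inBall_add {y y' : Fin 4 → ℤ → ℝ} {a b : ℝ} (h : cd.InBall j y a) (h' : cd.InBall j y' b) :
    cd.InBall j (y + y') (a + b) := by
  intro i k hk1 hk2
  have h1 := h i k hk1 hk2
  have h2 := h' i k hk1 hk2
  simp only [Pi.add_apply]
  rw [add_mul]
  exact (abs_add_le _ _).trans (add_le_add h1 h2)

/-- Negation preserves window balls. [folklore] -/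
theorem inBall_neg {y : Fin 4 → ℤ → ℝ} {a : ℝ} (h : cd.InBall j y a) : cd.InBall j (-y) a := by
  intro i k hk1 hk2
  simpa only [Pi.neg_apply, abs_neg] using h i k hk1 hk2

/-- Differences of window balls. [folklore] -/
theorem inBall_sub {y y' : Fin 4 → ℤ → ℝ} {a b : ℝ} (h : cd.InBall j y a) (h' : cd.InBall j y' b) :
    cd.InBall j (y - y') (a + b) := by
  simpa only [sub_eq_add_neg] using inBall_add h (inBall_neg h')

/-- Scalar multiples of window balls. [folklore] -/
theorem inBall_smul {y : Fin 4 → ℤ → ℝ} {a : ℝ} (r : ℝ) (h : cd.InBall j y a) :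
    cd.InBall j (r • y) (|r| * a) := by
  intro i k hk1 hk2
  simp only [Pi.smul_apply, smul_eq_mul, abs_mul, mul_assoc]
  exact mul_le_mul_of_nonneg_left (h i k hk1 hk2) (abs_nonneg r)

/-- The zero state lies in every ball of non-negative radius. [folklore] -/
theorem inBall_zero (hω : ∀ k, 0 < cd.ω j k) {a : ℝ} (ha : 0 ≤ a) : cd.InBall j 0 a :=
  fun i k _ _ => by simpa using mul_nonneg ha (hω k).le

/-- A window ball has non-negative radius (the window contains the shell `0`). [folklore] -/
theorem inBall_nonneg (hV : cd.Valid) (hω : ∀ k, 0 < cd.ω j k) {y : Fin 4 → ℤ → ℝ} {a : ℝ}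
    (h : cd.InBall j y a) : 0 ≤ a := by
  have h0 := h 0 0 (by linarith [Kb_nonneg hV]) (by linarith [one_le_Ka hV])
  exact nonneg_of_mul_nonneg_left ((abs_nonneg _).trans h0) (hω 0)

/-- Symmetry of the window distance. [folklore] -/
theorem inBall_sub_comm {y y' : Fin 4 → ℤ → ℝ} {a : ℝ} (h : cd.InBall j (y - y') a) :
    cd.InBall j (y' - y) a := by
  simpa only [neg_sub] using inBall_neg h

/-- Convexity of the κ-box: a point of the segment between two points of `x + Ball(κ)` lies in it. [folklore] -/
theorem inBall_convex {x z z' : Fin 4 → ℤ → ℝ} {κ σ : ℝ} (hz : cd.InBall j (z - x) κ)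
    (hz' : cd.InBall j (z' - x) κ) (hσ : σ ∈ Icc (0:ℝ) 1) :
    cd.InBall j (z' + σ • (z - z') - x) κ := by
  have e : z' + σ • (z - z') - x = (1 - σ) • (z' - x) + σ • (z - x) := by
    simp only [smul_sub, sub_smul, one_smul]; abel
  rw [e]
  have h := inBall_add (inBall_smul (1 - σ) hz') (inBall_smul σ hz)
  rwa [abs_of_nonneg (by linarith [hσ.2] : (0:ℝ) ≤ 1 - σ), abs_of_nonneg hσ.1,
    show (1 - σ) * κ + σ * κ = κ by ring] at h

/-- Two points of the segment between `z'` and `z` are `|σ − σ'|·d` apart. [folklore] -/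
theorem inBall_segment_sub {z z' : Fin 4 → ℤ → ℝ} {d σ σ' : ℝ} (hzz : cd.InBall j (z - z') d) :
    cd.InBall j ((z' + σ • (z - z')) - (z' + σ' • (z - z'))) (|σ - σ'| * d) := by
  have e : (z' + σ • (z - z')) - (z' + σ' • (z - z')) = (σ - σ') • (z - z') := by
    simp only [sub_smul]; abel
  rw [e]
  exact inBall_smul _ hzz

/-- SCALING of a window-profile bound for an `ℝ`-linear map: if `|ξ| ≤ a` (on the window) implies `|L ξ| ≤ b`,
then `|ξ| ≤ c·a` implies `|L ξ| ≤ c·b` for every `c ≥ 0` (for `c = 0` by a limiting argument, using `a ≥ 0`).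
[folklore] -/
theorem linear_scale {L : (Fin 4 → ℤ → ℝ) → (Fin 4 → ℤ → ℝ)} (hL : IsLinearMap ℝ L)
    {a b : Fin 4 → ℤ → ℝ} (ha : ∀ i k, -cd.Kb ≤ k → k ≤ cd.Ka → 0 ≤ a i k)
    (H : ∀ ξ : (Fin 4 → ℤ → ℝ), (∀ i k, -cd.Kb ≤ k → k ≤ cd.Ka → |ξ i k| ≤ a i k) →
      ∀ i k, -cd.Kb ≤ k → k ≤ cd.Ka → |L ξ i k| ≤ b i k)
    {c : ℝ} (hc : 0 ≤ c) {ξ : Fin 4 → ℤ → ℝ} (hξ : ∀ i k, -cd.Kb ≤ k → k ≤ cd.Ka → |ξ i k| ≤ c * a i k) :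
    ∀ i k, -cd.Kb ≤ k → k ≤ cd.Ka → |L ξ i k| ≤ c * b i k := by
  -- the positive case
  have key : ∀ r : ℝ, 0 < r → (∀ i k, -cd.Kb ≤ k → k ≤ cd.Ka → |ξ i k| ≤ r * a i k) →
      ∀ i k, -cd.Kb ≤ k → k ≤ cd.Ka → |L ξ i k| ≤ r * b i k := by
    intro r hr hr' i k hk1 hk2
    have h1 : ∀ i k, -cd.Kb ≤ k → k ≤ cd.Ka → |(r⁻¹ • ξ) i k| ≤ a i k := by
      intro i' k' hk1' hk2'
      have := hr' i' k' hk1' hk2'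
      rw [Pi.smul_apply, Pi.smul_apply, smul_eq_mul, abs_mul, abs_of_pos (inv_pos.mpr hr)]
      rwa [inv_mul_le_iff₀ hr]
    have h2 := H (r⁻¹ • ξ) h1 i k hk1 hk2
    have e : L ξ = r • L (r⁻¹ • ξ) := by
      rw [← hL.map_smul, smul_smul, mul_inv_cancel₀ hr.ne', one_smul]
    rw [e, Pi.smul_apply, Pi.smul_apply, smul_eq_mul, abs_mul, abs_of_pos hr]
    exact mul_le_mul_of_nonneg_left h2 hr.le
  rcases hc.lt_or_eq with hc' | hc'
  · exact key c hc' hξ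
  · subst hc'
    intro i k hk1 hk2
    rw [zero_mul]
    refine le_of_forall_pos_le_add fun ε hε => ?_
    set M : ℝ := |b i k| + 1 with hM
    have hMpos : 0 < M := by positivity
    have hε' : 0 < ε / M := div_pos hε hMpos
    have h1 : ∀ i k, -cd.Kb ≤ k → k ≤ cd.Ka → |ξ i k| ≤ ε / M * a i k := by
      intro i' k' hk1' hk2'
      have := hξ i' k' hk1' hk2'
      rw [zero_mul] at this
      exact this.trans (mul_nonneg hε'.le (ha i' k' hk1' hk2'))
    have h2 := key (ε / M) hε' h1 i k hk1 hk2
    calc |L ξ i k| ≤ ε / M * b i k := h2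
      _ ≤ ε / M * M := by
          refine mul_le_mul_of_nonneg_left ?_ hε'.le
          exact (le_abs_self _).trans (by linarith)
      _ = 0 + ε := by field_simp; ring

/-! ### Node times -/

/-- The node times are non-decreasing. [folklore] -/
theorem Tn_mono (hV : cd.Valid) (hj : j ≤ cd.N₀) {a b : ℕ} (hab : a ≤ b) (hb : b ≤ cd.S j) :
    cd.Tn j a ≤ cd.Tn j b := by
  obtain ⟨n, rfl⟩ := Nat.exists_eq_add_of_le hab
  induction n with
  | zero => simp
  | succ n ih =>
    have h1 : a + n < cd.S j := by omega
    calc cd.Tn j a ≤ cd.Tn j (a + n) := ih (by omega) (by omega)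
      _ ≤ cd.Tn j (a + n) + cd.h j (a + n) := le_add_of_nonneg_right (h_pos hV hj h1).le
      _ = cd.Tn j (a + n + 1) := (Tn_succ hV hj h1).symm

/-- The node times are non-negative. [folklore] -/
theorem Tn_nonneg (hV : cd.Valid) (hj : j ≤ cd.N₀) {s : ℕ} (hs : s ≤ cd.S j) : 0 ≤ cd.Tn j s := by
  rw [← Tn_zero hV hj]; exact Tn_mono hV hj (Nat.zero_le _) hs

/-- A node strictly before another is strictly earlier. [folklore] -/
theorem Tn_lt_Tn (hV : cd.Valid) (hj : j ≤ cd.N₀) {a b : ℕ} (hab : a < b) (hb : b ≤ cd.S j) :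
    cd.Tn j a < cd.Tn j b := by
  have h1 : a < cd.S j := by omega
  calc cd.Tn j a < cd.Tn j a + cd.h j a := lt_add_of_pos_right _ (h_pos hV hj h1)
    _ = cd.Tn j (a + 1) := (Tn_succ hV hj h1).symm
    _ ≤ cd.Tn j b := Tn_mono hV hj hab hb

/-- LOCATION of a time in a sub-step at or after a given one: for `Tn s₀ ≤ t ≤ Tn S` there is `s ≥ s₀`,
`s < S`, with `Tn s ≤ t ≤ Tn (s+1)`. [folklore] -/
theorem exists_substep {t : ℝ} {s₀ : ℕ} (hs₀ : s₀ < cd.S j)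
    (h0 : cd.Tn j s₀ ≤ t) (h1 : t ≤ cd.Tn j (cd.S j)) :
    ∃ s, s₀ ≤ s ∧ s < cd.S j ∧ cd.Tn j s ≤ t ∧ t ≤ cd.Tn j (s + 1) := by
  classical
  have hs₀' : s₀ ≤ cd.S j - 1 := by omega
  refine ⟨Nat.findGreatest (fun s => cd.Tn j s ≤ t) (cd.S j - 1), Nat.le_findGreatest hs₀' h0,
    lt_of_le_of_lt (Nat.findGreatest_le _) (by omega),
    Nat.findGreatest_spec (P := fun s => cd.Tn j s ≤ t) hs₀' h0, ?_⟩
  by_cases hlast : Nat.findGreatest (fun s => cd.Tn j s ≤ t) (cd.S j - 1) + 1 ≤ cd.S j - 1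
  · exact le_of_lt (not_le.mp
      (Nat.findGreatest_is_greatest (P := fun s => cd.Tn j s ≤ t) (Nat.lt_succ_self _) hlast))
  · have e : Nat.findGreatest (fun s => cd.Tn j s ≤ t) (cd.S j - 1) + 1 = cd.S j := by
      have := Nat.findGreatest_le (P := fun s => cd.Tn j s ≤ t) (cd.S j - 1)
      omega
    rw [e]; exact h1

end Summit.NavierStokesRegularity.NavierStokesRegularity.Theorems.TaylorModelReadout.G3

end
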